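import Summits.BirchSwinnertonDyer.BirchSwinnertonDyer.Theorems.PrintCFramBottomClassIndexLawFiveLeThetaCycleLegendreDescent
import Summits.BirchSwinnertonDyer.BirchSwinnertonDyer.Theorems.PrintCFramBottomClassIndexLawFiveLeCuspSeedValuation
import HarnessLib

/-!
# Crux `PrintCFram.BottomClassIndexLawFiveLe` (stmt-BirchSwinnertonDyer-20372), line `eisenstein-resource-bdp-line` (registry v22):
# `stub_cuspSeed` ⟸ ONE HYPOTHESIS IN q-EXPANSION CURRENCY — the Eisenstein cusp seed: a unit constant term at the cusp `0`
# forces a non-zero coefficient of the `m`-cut Cohen series mod `p`, which descends to an `m`-admissible imaginary quadratic field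
# with unit field factor (cell `bsd-print-cfram`, width seat `bsd-line-cfram-p1-w5` g5; THEOREMS ONLY, `--supports` 20372;
# BSD is not proved by any of this)

HONEST FRAMING. Nothing here is a statement about elliptic curves or BSD; no registered stub is closed. Registry v22's
`stub_cuspSeed` (= `hCusp` of `HeegnerFieldSupply.seedOff_six_of_cuspSeed_of_exc`, LEAD g12 p684982, «print-derivable, typing owed»)
says: for a class datum `(p, m, χ, k)` at the six leaf primes with NO prime `ℓ ∣ m`, `ℓ ≡ ±1 (mod p)`, some imaginary quadratic `K₀`
(`d_{K₀}` odd `< −4`, every `q ∣ m` split, any behaviour at `p`) has a unit field factor `p ∤ B_{k,(χε_{K₀})~}/k` — with NO regularity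
and NO locus hypothesis. The derivation (crux notes `Lines/eisenstein-resource-bdp-line-lead-g12.md` §11 and this seat's
`…-w5g5-cusp-seed.md` Lemmas A–D, numerically certified): the `m`-cut Cohen–Eisenstein series
`F_e(z) = Σ_{n'∈S'} H(k, m n') e(n'z)` (cut `S'` = {`n' ≡ 3 (4)` [`≡ 7 (8)` if `2 ∣ m`], `J(−n'|q) = 1` for odd `q ∣ m`, `3 ∤ n'`}) is a
holomorphic form of weight `k + 1/2` and level prime to `p` [Cohen 1975 Thm 3.1, Shimura 1973 Prop. 1.5] whose constant term at the cusp
`0` is `i^{−(k+1/2)} · u · √(2m) · C` with `u ∈ ℤ[1/6]^× · u'_k` a `p`-unit and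
`C = B_{2k}/k! · m^{k−1} · Π_{q∣m} (q−1)(q^{2k}−1)/q^{2k+1}`; by Katz's q-expansion principle at the cusp `0` (applied to `F_e²`),
`F_e ≡ 0 (mod p)` forces `p ∣ C`. THIS FILE packages that as ONE hypothesis in q-expansion currency — a field `𝔽` of characteristic
`p`, `ι : ℤ_p → 𝔽`, a power series `G ∈ 𝔽⟦q⟧` (`F_e mod p`) supported on the cut with the Cohen DICTIONARY on the cut
(`coeff (m n₀ f²) G = t · ι x`, `x = k⁻¹B_{k,(χ↑ε_K↑)~}`, `t = 1` at `f = 1`, exactly as in w8 g6's `ThetaCycle.atP_of_cutForm`, p686525, at the auxiliary datum `(r,e) = (3,0)`) and the CUSP CONJUNCT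
«`G = 0 ⟹ ι C = 0`» — and proves **`stub_cuspSeed` ⟸ that hypothesis** (`cuspSeed_six_of_cutForm`, conclusion = the registered text
VERBATIM), the arithmetic being DISCHARGED: on a class with no prime `ℓ ∣ m`, `ℓ ≡ ±1 (mod p)`, `C` is a `p`-adic unit
(`CuspSeed.padicValuation_cuspConstant_eq_one_iff`, p686210: Euler's criterion, Kummer's congruence, `h(−p) < p`), so `ι C ≠ 0`, so
`G ≠ 0`, so some `coeff a G ≠ 0` with `a = m·n₁·f²` in the cut, and `K₀ := ℚ(√−n₁)` is imaginary quadratic with every `q ∣ m` split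
(Jacobi / `mod 8` clauses), `−n₁ < −4` (`3 ∤ n'`), a Kronecker character (`KrizLiBinders.exists_isKroneckerCharacterOf_of_discr`) and
unit field factor (`ι x ≠ 0`) — the descent of `atP_of_cutForm` §§f–i WITHOUT the θ-cycle engine and WITHOUT a seed. NOTHING modular is
discharged: the hypothesis is the typing item (Cohen–Eisenstein series, `U_m`, twists, expansions at cusps, the q-expansion principle —
none in Mathlib). NET with p686525: both print-derivable stubs of v22 (`stub_atP`, `stub_cuspSeed`) are kernel theorems modulo typed
hypotheses about ONE object, the cut Cohen series mod `p`. beyond-print theorem: NO.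

References: [Cohen1975] Thm. 3.1; [Katz1973] §1.6 (q-expansion principle); [IrelandRosen1982] Ch. 15 §2; [Marcus2018] Ch. 3 Thm. 25;
[Cox2013] Lemma 1.14; crux notes `Lines/eisenstein-resource-bdp-line-w5g5-cusp-seed.md` §§0–7, 12–13.
-/

set_option autoImplicit false
-- summit-side namespace `Summit.BirchSwinnertonDyer.BirchSwinnertonDyer.…` (single-conjunct summit, D-0017 layout)
set_option linter.dupNamespace false

noncomputable section

open scoped Classical NumberTheorySymbols
open NumberField DirichletCharacter Literature.NumberTheory.LFunctions
  Literature.NumberTheory.EllipticCurves Literature.NumberTheory.EllipticCurves.KrizLi2019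
  Literature.NumberTheory.QuadraticFields

namespace Summit.BirchSwinnertonDyer.BirchSwinnertonDyer.Theorems.PrintCFram.CuspSeed

open Summit.BirchSwinnertonDyer.BirchSwinnertonDyer.Theorems.PrintCFram
open Summit.BirchSwinnertonDyer.BirchSwinnertonDyer.Theorems.PrintCFram.ThetaCycle
open PowerSeries

/-! ## §1 The cusp seed for one class datum ⟸ the cut form with the cusp conjunct -/

/-- **(CuspSeed⁶) for one class datum ⟸ the cut-form hypothesis with the cusp conjunct.** For `p ≡ 3 (mod 4)`, `p ≠ 3`, `m ⊥ p`,
a Dirichlet character `χ` mod `m` with values in `ℚ_p`, `k ∈ {(p+1)/4, (3p−1)/4}`, and NO prime `ℓ ∣ m` with `ℓ % p ∈ {1, p − 1}`: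
ASSUME (`hcusp`) a field `𝔽` of characteristic `p`, a ring map `ι : ℤ_p → 𝔽` and `G ∈ 𝔽⟦q⟧` supported on the `m`-cut
{`m·n'` : `n' ≡ 3 (4)`, `J(−n' | q) = 1` for odd primes `q ∣ m`, `n' ≡ 7 (8)` if `2 ∣ m`, `3 ∤ n'`}, with the dictionary
`coeff (m n₀ f²) G = t · ι x`, `x = k⁻¹B_{k,(χ↑ε_K↑)~}` on the cut [Cohen1975 Thm. 3.1: the cut Cohen–Eisenstein series mod `p`] and
the cusp conjunct «`G = 0 ⟹ ι C = 0`» for `C = B_{2k}/k!·m^{k−1}·Π_{q∣m}(q−1)(q^{2k}−1)/q^{2k+1}` [Katz1973 §1.6 at the cusp `0` +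
crux notes w5g5 Lemmas A–D]. THEN some imaginary quadratic `K₀` with every prime of `m` split, `d_{K₀}` odd `< −4`, a Kronecker
character and unit field factor exists — the conclusion of `stub_cuspSeed`. Kernel: `C` is a unit (p686210), hence `G ≠ 0`, then the
descent. [cite: Cohen1975, Thm. 3.1] [cite: Katz1973, §1.6] [cite: Marcus2018, Ch. 3 Thm. 25] [cite: Cox2013, §1.C Lemma 1.14] -/
theorem cuspSeed_of_cutForm (p : ℕ) [Fact p.Prime] (m : ℕ) [NeZero m] (χ : DirichletCharacter ℚ_[p] m) (k : ℕ)
    (hp4 : p % 4 = 3) (hp3 : p ≠ 3) (hmp : m.Coprime p) (hk : k = (p + 1) / 4 ∨ k = (3 * p - 1) / 4)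
    (hgen : ¬ ∃ ℓ : ℕ, ℓ.Prime ∧ ℓ ∣ m ∧ (ℓ % p = 1 ∨ ℓ % p = p - 1))
    (hcusp : ∃ (𝔽 : Type) (_ : Field 𝔽) (_ : CharP 𝔽 p) (ι : ℤ_[p] →+* 𝔽) (G : PowerSeries 𝔽),
      (∀ a : ℕ, coeff a G ≠ 0 →
        m ∣ a ∧ a / m % 4 = 3 ∧ (∀ q : ℕ, q.Prime → q ∣ m → q ≠ 2 → jacobiSym (-((a / m : ℕ) : ℤ)) q = 1) ∧
          (2 ∣ m → a / m % 8 = 7) ∧ ¬ 3 ∣ a / m) ∧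
      (∀ (n₀ f : ℕ) (K : Type) [Field K] [NumberField K] (εK : DirichletCharacter ℚ_[p] (NumberField.discr K).natAbs),
        Squarefree n₀ → n₀ % 4 = 3 → 0 < f →
        (m ∣ m * (n₀ * f ^ 2) ∧ m * (n₀ * f ^ 2) / m % 4 = 3 ∧
          (∀ q : ℕ, q.Prime → q ∣ m → q ≠ 2 → jacobiSym (-((m * (n₀ * f ^ 2) / m : ℕ) : ℤ)) q = 1) ∧
          (2 ∣ m → m * (n₀ * f ^ 2) / m % 8 = 7) ∧ ¬ 3 ∣ m * (n₀ * f ^ 2) / m) →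
        IsImaginaryQuadratic K → NumberField.discr K = -(n₀ : ℤ) → IsKroneckerCharacterOf K εK →
        ∃ (t : ℤ) (x : ℤ_[p]), (f = 1 → t = 1) ∧
          (x : ℚ_[p]) = (k : ℚ_[p])⁻¹ * @generalizedBernoulli ℚ_[p] _ _
            (changeLevel (dvd_mul_right m (NumberField.discr K).natAbs) χ *
              changeLevel (dvd_mul_left (NumberField.discr K).natAbs m) εK).conductor ⟨conductor_ne_zero _⟩ k
            (changeLevel (dvd_mul_right m (NumberField.discr K).natAbs) χ *
              changeLevel (dvd_mul_left (NumberField.discr K).natAbs m) εK).primitiveCharacter ∧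
          coeff (m * (n₀ * f ^ 2)) G = (t : 𝔽) * ι x) ∧
      (G = 0 → ∀ x : ℤ_[p], (x : ℚ_[p]) =
        ((bernoulli (2 * k) / (k.factorial : ℚ) * (m : ℚ) ^ (k - 1) *
          ∏ q ∈ m.primeFactors, ((q : ℚ) - 1) * ((q : ℚ) ^ (2 * k) - 1) / (q : ℚ) ^ (2 * k + 1) : ℚ) : ℚ_[p]) →
        ι x = 0)) :
    ∃ (K₀ : Type) (_ : Field K₀) (_ : NumberField K₀) (ε₀ : DirichletCharacter ℚ_[p] (NumberField.discr K₀).natAbs),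
      IsImaginaryQuadratic K₀ ∧
      (∀ q : ℕ, q.Prime → q ∣ m → ((Ideal.span {(q : ℤ)}).primesOver (𝓞 K₀)).ncard = 2) ∧
      Odd (NumberField.discr K₀) ∧ NumberField.discr K₀ < -4 ∧ IsKroneckerCharacterOf K₀ ε₀ ∧
      ¬ ‖(k : ℚ_[p])⁻¹ * @generalizedBernoulli ℚ_[p] _ _
          (changeLevel (dvd_mul_right m (NumberField.discr K₀).natAbs) χ *
            changeLevel (dvd_mul_left (NumberField.discr K₀).natAbs m) ε₀).conductor ⟨conductor_ne_zero _⟩ k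
          (changeLevel (dvd_mul_right m (NumberField.discr K₀).natAbs) χ *
            changeLevel (dvd_mul_left (NumberField.discr K₀).natAbs m) ε₀).primitiveCharacter‖ ≤ (p : ℝ)⁻¹ := by
  have hpp : p.Prime := Fact.out
  have hp1 : (1 : ℝ) < p := by exact_mod_cast hpp.one_lt
  have hm0 : 0 < m := Nat.pos_of_ne_zero (NeZero.ne m)
  obtain ⟨𝔽, instF, instC, ι, G, hsupp, hdict, hcz⟩ := hcusp
  -- §a the cusp constant is a `p`-adic unit, so `G ≠ 0`
  set C : ℚ := bernoulli (2 * k) / (k.factorial : ℚ) * (m : ℚ) ^ (k - 1) *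
    ∏ q ∈ m.primeFactors, ((q : ℚ) - 1) * ((q : ℚ) ^ (2 * k) - 1) / (q : ℚ) ^ (2 * k + 1) with hC
  have hv : Rat.padicValuation p C = 1 :=
    (padicValuation_cuspConstant_eq_one_iff hp4 hp3 (NeZero.ne m) hmp hk).mpr hgen
  have hnorm : ‖((C : ℚ) : ℚ_[p])‖ = 1 := (norm_eq_one_iff_padicValuation_eq_one C).mpr hv
  have hG : G ≠ 0 := by
    intro hG0
    let x : ℤ_[p] := ⟨((C : ℚ) : ℚ_[p]), hnorm.le⟩
    have hx0 : ι x = 0 := hcz hG0 x rfl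
    refine map_ne_zero_of_not_norm_le ι (x := x) ?_ hx0
    intro hle
    have hx1 : ‖(x : ℚ_[p])‖ = 1 := hnorm
    rw [hx1] at hle
    exact not_lt.mpr hle (inv_lt_one_of_one_lt₀ hp1)
  -- §b a non-zero coefficient, its index `a = m · n₁ · f²`, `n₁` squarefree `≡ 3 (4)`, `n₁ ≥ 7`
  obtain ⟨a, ha⟩ : ∃ a : ℕ, coeff a G ≠ 0 := by
    by_contra h
    push Not at h
    exact hG (PowerSeries.ext fun n => by rw [h n, map_zero])
  obtain ⟨hma, ha4, -, -, ha3⟩ := hsupp a ha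
  have hn'0 : 0 < a / m := Nat.pos_of_ne_zero fun h => by rw [h] at ha4; norm_num at ha4
  obtain ⟨n₁, f, hn₁0, hf0, hfn, hn₁sq⟩ := Nat.sq_mul_squarefree_of_pos hn'0
  obtain ⟨-, hn₁4, hn₁8⟩ := mod_four_of_sq_mul (f := f) (n₁ := n₁) (by rw [hfn]; exact ha4)
  have han₁ : a = m * (n₁ * f ^ 2) := by
    rw [mul_comm n₁ (f ^ 2), hfn, Nat.mul_div_cancel' hma]
  have hn₁3 : n₁ ≠ 3 := by
    intro h3
    apply ha3
    rw [← hfn, h3]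
    exact ⟨f ^ 2, by ring⟩
  have hn₁7 : 4 < n₁ := by omega
  -- §c the cut conditions at `a = m · (n₁ f²)`
  have ha' : coeff (m * (n₁ * f ^ 2)) G ≠ 0 := han₁ ▸ ha
  have hcut₁ := hsupp _ ha'
  obtain ⟨-, -, hJ', h8', -⟩ := hsupp _ ha'
  have hdiv : m * (n₁ * f ^ 2) / m = n₁ * f ^ 2 := Nat.mul_div_cancel_left _ hm0
  rw [hdiv] at hJ' h8'
  have hJq : ∀ q : ℕ, q.Prime → q ∣ m → q ≠ 2 → jacobiSym (-(n₁ : ℤ)) q = 1 := by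
    intro q hq hqm hq2
    have h := hJ' q hq hqm hq2
    have hcast : (-((n₁ * f ^ 2 : ℕ) : ℤ)) = (-(n₁ : ℤ)) * (f : ℤ) ^ 2 := by
      push_cast
      ring
    rw [hcast, jacobiSym.mul_left, jacobiSym.pow_left] at h
    rcases jacobiSym.trichotomy (f : ℤ) q with h0 | h0 | h0
    · rw [h0] at h
      norm_num at h
    · rw [h0] at h
      simpa using h
    · rw [h0] at h
      simpa using h
  have hn₁8' : 2 ∣ m → n₁ % 8 = 7 := fun h2m => hn₁8 (by rw [mul_comm]; exact h8' h2m)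
  -- §d the field `K₀ = ℚ(√−n₁)`, its Kronecker character, and the dictionary
  have hsqZ : Squarefree (-(n₁ : ℤ)) := by
    rw [← Int.squarefree_natAbs, Int.natAbs_neg, Int.natAbs_natCast]
    exact hn₁sq
  obtain ⟨K, iF, iN, h2, hd⟩ := Quadratic.exists_numberField_discr_eq (D := -(n₁ : ℤ))
    (Or.inl ⟨by omega, hsqZ, by omega⟩)
  have hKim : IsImaginaryQuadratic K := isImaginaryQuadratic_of_discr_eq_of_neg h2 hd (by omega)
  obtain ⟨εK, hεK, -⟩ :=
    KrizLiBinders.exists_isKroneckerCharacterOf_of_discr (p := p) h2 (m := n₁) hn₁sq (Or.inr ⟨hd, hn₁4⟩)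
  obtain ⟨t, x, -, hx, hc⟩ := hdict n₁ f K εK hn₁sq hn₁4 hf0 hcut₁ hKim hd hεK
  have hxu : ι x ≠ 0 := by
    intro h0
    apply ha'
    rw [hc, h0, mul_zero]
  refine ⟨K, iF, iN, εK, hKim, ?_, ?_, ?_, hεK, ?_⟩
  · intro q hq hqm
    by_cases hq2 : q = 2
    · subst hq2
      have h8 : NumberField.discr K % 8 = 1 := by
        rw [hd]
        have := hn₁8' hqm
        omega
      simpa using (Quadratic.ncard_primesOver_two_eq_two_iff h2).mpr h8
    · rw [Quadratic.ncard_primesOver_eq_two_iff_jacobiSym h2 hq hq2, hd]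
      exact hJq q hq hqm hq2
  · rw [hd, Int.odd_iff]
    omega
  · rw [hd]
    omega
  · rw [← hx]
    exact not_norm_le_of_map_ne_zero ι hxu

/-! ## §2 Registry v22's `stub_cuspSeed` VERBATIM ⟸ the cut-form hypothesis for all class data -/

/-- **`stub_cuspSeed` ⟸ (CuspCutForm⁶).** The hypothesis `hCusp` of `HeegnerFieldSupply.seedOff_six_of_cuspSeed_of_exc` (registry
v22's `stub_cuspSeed`, text VERBATIM as the conclusion here) follows from the cut-form-with-cusp-conjunct hypothesis of
`cuspSeed_of_cutForm` at every class datum of the six leaf primes (all `≡ 3 (mod 4)` and `≠ 3`). Pure logic on top of §1.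
[cite: Cohen1975, Thm. 3.1] [cite: Katz1973, §1.6] -/
theorem cuspSeed_six_of_cutForm
    (hcut : ∀ (p : ℕ) [Fact p.Prime] (m : ℕ) [NeZero m] (χ : DirichletCharacter ℚ_[p] m) (k : ℕ),
      (p = 7 ∨ p = 11 ∨ p = 19 ∨ p = 43 ∨ p = 67 ∨ p = 163) →
      m.Coprime p → χ.IsPrimitive → χ.IsQuadratic → (k = (p + 1) / 4 ∨ k = (3 * p - 1) / 4) →
      2 ≤ k → k ≤ p - 2 → χ (-1) * (-1) ^ k = -1 →
      ∃ (𝔽 : Type) (_ : Field 𝔽) (_ : CharP 𝔽 p) (ι : ℤ_[p] →+* 𝔽) (G : PowerSeries 𝔽),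
        (∀ a : ℕ, coeff a G ≠ 0 →
          m ∣ a ∧ a / m % 4 = 3 ∧ (∀ q : ℕ, q.Prime → q ∣ m → q ≠ 2 → jacobiSym (-((a / m : ℕ) : ℤ)) q = 1) ∧
            (2 ∣ m → a / m % 8 = 7) ∧ ¬ 3 ∣ a / m) ∧
        (∀ (n₀ f : ℕ) (K : Type) [Field K] [NumberField K] (εK : DirichletCharacter ℚ_[p] (NumberField.discr K).natAbs),
          Squarefree n₀ → n₀ % 4 = 3 → 0 < f →
          (m ∣ m * (n₀ * f ^ 2) ∧ m * (n₀ * f ^ 2) / m % 4 = 3 ∧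
            (∀ q : ℕ, q.Prime → q ∣ m → q ≠ 2 → jacobiSym (-((m * (n₀ * f ^ 2) / m : ℕ) : ℤ)) q = 1) ∧
            (2 ∣ m → m * (n₀ * f ^ 2) / m % 8 = 7) ∧ ¬ 3 ∣ m * (n₀ * f ^ 2) / m) →
          IsImaginaryQuadratic K → NumberField.discr K = -(n₀ : ℤ) → IsKroneckerCharacterOf K εK →
          ∃ (t : ℤ) (x : ℤ_[p]), (f = 1 → t = 1) ∧
            (x : ℚ_[p]) = (k : ℚ_[p])⁻¹ * @generalizedBernoulli ℚ_[p] _ _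
              (changeLevel (dvd_mul_right m (NumberField.discr K).natAbs) χ *
                changeLevel (dvd_mul_left (NumberField.discr K).natAbs m) εK).conductor ⟨conductor_ne_zero _⟩ k
              (changeLevel (dvd_mul_right m (NumberField.discr K).natAbs) χ *
                changeLevel (dvd_mul_left (NumberField.discr K).natAbs m) εK).primitiveCharacter ∧
            coeff (m * (n₀ * f ^ 2)) G = (t : 𝔽) * ι x) ∧
        (G = 0 → ∀ x : ℤ_[p], (x : ℚ_[p]) =
          ((bernoulli (2 * k) / (k.factorial : ℚ) * (m : ℚ) ^ (k - 1) *
            ∏ q ∈ m.primeFactors, ((q : ℚ) - 1) * ((q : ℚ) ^ (2 * k) - 1) / (q : ℚ) ^ (2 * k + 1) : ℚ) : ℚ_[p]) →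
          ι x = 0)) :
    ∀ (p : ℕ) [Fact p.Prime] (m : ℕ) [NeZero m] (χ : DirichletCharacter ℚ_[p] m) (k : ℕ),
      (p = 7 ∨ p = 11 ∨ p = 19 ∨ p = 43 ∨ p = 67 ∨ p = 163) →
      m.Coprime p → χ.IsPrimitive → χ.IsQuadratic → (k = (p + 1) / 4 ∨ k = (3 * p - 1) / 4) →
      2 ≤ k → k ≤ p - 2 → χ (-1) * (-1) ^ k = -1 →
      ¬ (∃ ℓ : ℕ, ℓ.Prime ∧ ℓ ∣ m ∧ (ℓ % p = 1 ∨ ℓ % p = p - 1)) →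
      ∃ (K₀ : Type) (_ : Field K₀) (_ : NumberField K₀) (ε₀ : DirichletCharacter ℚ_[p] (NumberField.discr K₀).natAbs),
        IsImaginaryQuadratic K₀ ∧
        (∀ q : ℕ, q.Prime → q ∣ m → ((Ideal.span {(q : ℤ)}).primesOver (𝓞 K₀)).ncard = 2) ∧
        Odd (NumberField.discr K₀) ∧ NumberField.discr K₀ < -4 ∧ IsKroneckerCharacterOf K₀ ε₀ ∧
        ¬ ‖(k : ℚ_[p])⁻¹ * @generalizedBernoulli ℚ_[p] _ _
            (changeLevel (dvd_mul_right m (NumberField.discr K₀).natAbs) χ *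
              changeLevel (dvd_mul_left (NumberField.discr K₀).natAbs m) ε₀).conductor ⟨conductor_ne_zero _⟩ k
            (changeLevel (dvd_mul_right m (NumberField.discr K₀).natAbs) χ *
              changeLevel (dvd_mul_left (NumberField.discr K₀).natAbs m) ε₀).primitiveCharacter‖ ≤ (p : ℝ)⁻¹ := by
  intro p _ m _ χ k hp6 hmp hprim hquad hk h2k hkp hpar hgen
  have hp4 : p % 4 = 3 := by rcases hp6 with h | h | h | h | h | h <;> omega
  have hp3 : p ≠ 3 := by rcases hp6 with h | h | h | h | h | h <;> omega
  exact cuspSeed_of_cutForm p m χ k hp4 hp3 hmp hk hgen (hcut p m χ k hp6 hmp hprim hquad hk h2k hkp hpar)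

end Summit.BirchSwinnertonDyer.BirchSwinnertonDyer.Theorems.PrintCFram.CuspSeed

end
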